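import Mathlib.RingTheory.RootsOfUnity.PrimitiveRoots
import Mathlib.Tactic.NormNum.Prime
import Summits.MatrixMultiplication.OmegaCensus.BoxBadAtomsFrobeniusBridge
import Summits.MatrixMultiplication.OmegaCensus.BoxBadFrobeniusPQ1
import Summits.MatrixMultiplication.OmegaCensus.BoxBadFrobeniusPQ2
import Summits.MatrixMultiplication.OmegaCensus.BoxBadFrobeniusPQ3
import Summits.MatrixMultiplication.OmegaCensus.BoxBadFrobeniusPQ4
import Summits.MatrixMultiplication.OmegaCensus.BoxBadFrobeniusPQ5
import Summits.MatrixMultiplication.OmegaCensus.BoxBadFrobeniusPQ6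
import Summits.MatrixMultiplication.OmegaCensus.BoxBadFrobeniusPatterns
import Summits.MatrixMultiplication.OmegaCensus.BoxBadFrobeniusPatterns3
import Summits.MatrixMultiplication.OmegaCensus.BoxBadFrobeniusRows

/-!
# ω-census, family (b3): conjecture C9 (b) — one Frobenius model per pair suffices; nineteen atoms `A(p,q)`, `q ≥ 5`, in relation form

HONEST FRAMING (pub-omega census; verbatim): lottery ticket; floor = certified bounds/negative ranges.
Census BOOKKEEPING (conjecture C9 of the cell, STRUCTURE.md §2, `BoxRatioSectionLaw`; pub-omega kernel-l4 gen 17, task K-5″).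
Nothing here is progress on `ω`.

* `MetaCyc.powHom` — the root change `ℤ/N ⋊_u ℤ/q →* ℤ/N ⋊_v ℤ/q`, `(i, t) ↦ (i, m t)`, when `v^m = u` (injective if
  `m ≢ 0 (mod q)`, `q` prime); `MetaCyc.not_boxUseful_of_one_root` — for primes `p, q`, if `ℤ/p ⋊_u ℤ/q` is box-useless for ONE
  non-trivial `q`-th root of unity `u`, it is box-useless for every one (the roots are the powers of any of them).
* **`atomBad_of_frobenius_model`** — primes `p ≠ q`, one non-trivial `q`-th root of unity `u` mod `p` with `ℤ/p ⋊_u ℤ/q` box-useless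
  ⇒ `AtomBad p q` (`BoxBadAtomsFrobeniusBridge.atomBad_of_frobenius_models` + the root change).
* Instances from the cell's kernel certificates (stpp-1: `BoxBadFrobeniusPQ1–6`, `…Patterns`, `…Patterns3`, `…Rows`):
  `AtomBad p q` for `(p,q) ∈ {(11,5), (31,5), (41,5), (61,5), (71,5), (101,5), (131,5), (151,5), (181,5), (191,5), (29,7), (43,7),
  (71,7), (113,7), (127,7), (23,11), (67,11), (89,11), (53,13)}` — the first atoms with `q ≥ 5` closed in relation form.
-/

namespace Summit.MatrixMultiplication.OmegaCensus

universe w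

namespace MetaCyc

variable {N q : ℕ}

/-- `v ^ (k % q) = v ^ k` when `v ^ q = 1` (ring version). [folklore] -/
theorem pow_mod_of_pow_eq_one {R : Type*} [Monoid R] {v : R} (hv : v ^ q = 1) (k : ℕ) : v ^ (k % q) = v ^ k := by
  conv_rhs => rw [← Nat.mod_add_div k q, pow_add, pow_mul, hv, one_pow, mul_one]

/-- **Root change `ℤ/N ⋊_u ℤ/q →* ℤ/N ⋊_v ℤ/q`**, `a^i b^t ↦ a^i b^{m t}`, for `v^m = u`. [folklore] -/
def powHom [NeZero q] (u v : ZMod N) [Fact (u ^ q = 1)] [hv : Fact (v ^ q = 1)] (m : ℕ) (hm : v ^ m = u) :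
    MetaCyc N q u →* MetaCyc N q v where
  toFun x := ⟨x.i, (m : ZMod q) * x.t⟩
  map_one' := by simp [one_def]
  map_mul' x y := by
    apply ext
    · simp only [mul_def]
      congr 2
      unfold act
      rw [ZMod.val_mul, ZMod.val_natCast,
        show m % q * x.t.val % q = m * x.t.val % q by rw [Nat.mul_mod, Nat.mod_mod, ← Nat.mul_mod],
        pow_mod_of_pow_eq_one hv.out, pow_mul, hm]
    · simp only [mul_def, mul_add]

/-- `powHom` is injective when `m ≢ 0 (mod q)`, `q` prime. [folklore] -/
theorem powHom_injective [Fact q.Prime] (u v : ZMod N) [Fact (u ^ q = 1)] [Fact (v ^ q = 1)] (m : ℕ) (hm : v ^ m = u)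
    (hmz : (m : ZMod q) ≠ 0) : Function.Injective (powHom (q := q) u v m hm) := by
  intro x y h
  have hi := congrArg MetaCyc.i h
  have ht := congrArg MetaCyc.t h
  change x.i = y.i at hi
  change (m : ZMod q) * x.t = (m : ZMod q) * y.t at ht
  exact ext hi (mul_left_cancel₀ hmz ht)

/-- **One root suffices** (`q` prime): if `ℤ/p ⋊_u ℤ/q` is box-useless for one non-trivial `q`-th root of unity `u` mod the prime
`p`, then it is for every non-trivial `q`-th root `v` (`u = v^m`, and `powHom` embeds the `u`-group into the `v`-group). [folklore] -/
theorem not_boxUseful_of_one_root {p : ℕ} [Fact p.Prime] [Fact q.Prime] (u : ZMod p) [hu : Fact (u ^ q = 1)] (hu1 : u ≠ 1)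
    (T : ¬ BoxUseful (MetaCyc p q u)) (v : ZMod p) [Fact (v ^ q = 1)] (hv1 : v ≠ 1) : ¬ BoxUseful (MetaCyc p q v) := by
  have hq : q.Prime := Fact.out
  have hv : IsPrimitiveRoot v q := IsPrimitiveRoot.iff_orderOf.2 (orderOf_eq_prime Fact.out hv1)
  obtain ⟨m, hmq, hm⟩ := hv.eq_pow_of_pow_eq_one hu.out
  have hm0 : m ≠ 0 := by rintro rfl; rw [pow_zero] at hm; exact hu1 hm.symm
  have hmz : (m : ZMod q) ≠ 0 := by
    rw [Ne, ZMod.natCast_eq_zero_iff]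
    exact fun h => absurd (Nat.le_of_dvd (Nat.pos_of_ne_zero hm0) h) (by omega)
  exact not_boxUseful_of_injective' (powHom (q := q) u v m hm) (powHom_injective u v m hm hmz) T

end MetaCyc

/-- **`AtomBad p q` from ONE Frobenius model** (primes `p ≠ q`, `p ≡ 1 (mod q)` witnessed by a non-trivial `q`-th root of unity
`u` mod `p`): if `ℤ/p ⋊_u ℤ/q` is box-useless then every finite group with an `A(p,q)`-configuration is box-useless. [folklore] -/
theorem atomBad_of_frobenius_model {p q : ℕ} [Fact p.Prime] [Fact q.Prime] (hpq : p ≠ q) (u : ZMod p) [hu : Fact (u ^ q = 1)]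
    (hu1 : u ≠ 1) (T : ¬ BoxUseful (MetaCyc p q u)) : AtomBad.{w} p q :=
  atomBad_of_frobenius_models hpq u hu.out hu1 fun v _ hv1 => MetaCyc.not_boxUseful_of_one_root u hu1 T v hv1

/-! ### Nineteen atoms with `q ≥ 5`, from the cell's kernel certificates -/

section Instances

open MetaCyc

/-- `AtomBad 11 5` (`ℤ/11 ⋊ ℤ/5`, `not_boxUseful_f55`). [folklore] -/
theorem atomBad_11_5 : AtomBad.{w} 11 5 := by
  have hpq : (11 : ℕ) ≠ 5 := by decide
  have hu1 : (3 : ZMod 11) ≠ 1 := by decide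
  haveI : Fact (Nat.Prime 11) := ⟨by norm_num⟩
  haveI : Fact (Nat.Prime 5) := ⟨by norm_num⟩
  exact atomBad_of_frobenius_model hpq (3 : ZMod 11) hu1 not_boxUseful_f55

/-- `AtomBad 31 5`. [folklore] -/
theorem atomBad_31_5 : AtomBad.{w} 31 5 := by
  have hpq : (31 : ℕ) ≠ 5 := by decide
  have hu1 : (2 : ZMod 31) ≠ 1 := by decide
  haveI : Fact (Nat.Prime 31) := ⟨by norm_num⟩
  haveI : Fact (Nat.Prime 5) := ⟨by norm_num⟩
  exact atomBad_of_frobenius_model hpq (2 : ZMod 31) hu1 not_boxUseful_frob155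

/-- `AtomBad 41 5`. [folklore] -/
theorem atomBad_41_5 : AtomBad.{w} 41 5 := by
  have hpq : (41 : ℕ) ≠ 5 := by decide
  have hu1 : (10 : ZMod 41) ≠ 1 := by decide
  haveI : Fact (Nat.Prime 41) := ⟨by norm_num⟩
  haveI : Fact (Nat.Prime 5) := ⟨by norm_num⟩
  exact atomBad_of_frobenius_model hpq (10 : ZMod 41) hu1 not_boxUseful_frob205

/-- `AtomBad 61 5`. [folklore] -/
theorem atomBad_61_5 : AtomBad.{w} 61 5 := by
  have hpq : (61 : ℕ) ≠ 5 := by decide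
  have hu1 : (9 : ZMod 61) ≠ 1 := by decide
  haveI : Fact (Nat.Prime 61) := ⟨by norm_num⟩
  haveI : Fact (Nat.Prime 5) := ⟨by norm_num⟩
  exact atomBad_of_frobenius_model hpq (9 : ZMod 61) hu1 not_boxUseful_frob305

/-- `AtomBad 71 5`. [folklore] -/
theorem atomBad_71_5 : AtomBad.{w} 71 5 := by
  have hpq : (71 : ℕ) ≠ 5 := by decide
  have hu1 : (5 : ZMod 71) ≠ 1 := by decide
  haveI : Fact (Nat.Prime 71) := ⟨by norm_num⟩
  haveI : Fact (Nat.Prime 5) := ⟨by norm_num⟩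
  exact atomBad_of_frobenius_model hpq (5 : ZMod 71) hu1 not_boxUseful_frob355

/-- `AtomBad 101 5`. [folklore] -/
theorem atomBad_101_5 : AtomBad.{w} 101 5 := by
  have hpq : (101 : ℕ) ≠ 5 := by decide
  have hu1 : (36 : ZMod 101) ≠ 1 := by decide
  haveI : Fact (Nat.Prime 101) := ⟨by norm_num⟩
  haveI : Fact (Nat.Prime 5) := ⟨by norm_num⟩
  exact atomBad_of_frobenius_model hpq (36 : ZMod 101) hu1 not_boxUseful_frob505

/-- `AtomBad 131 5`. [folklore] -/
theorem atomBad_131_5 : AtomBad.{w} 131 5 := by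
  have hpq : (131 : ℕ) ≠ 5 := by decide
  have hu1 : (53 : ZMod 131) ≠ 1 := by decide
  haveI : Fact (Nat.Prime 131) := ⟨by norm_num⟩
  haveI : Fact (Nat.Prime 5) := ⟨by norm_num⟩
  exact atomBad_of_frobenius_model hpq (53 : ZMod 131) hu1 not_boxUseful_frob655

/-- `AtomBad 151 5`. [folklore] -/
theorem atomBad_151_5 : AtomBad.{w} 151 5 := by
  have hpq : (151 : ℕ) ≠ 5 := by decide
  have hu1 : (8 : ZMod 151) ≠ 1 := by decide
  haveI : Fact (Nat.Prime 151) := ⟨by norm_num⟩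
  haveI : Fact (Nat.Prime 5) := ⟨by norm_num⟩
  exact atomBad_of_frobenius_model hpq (8 : ZMod 151) hu1 not_boxUseful_frob755

/-- `AtomBad 181 5`. [folklore] -/
theorem atomBad_181_5 : AtomBad.{w} 181 5 := by
  have hpq : (181 : ℕ) ≠ 5 := by decide
  have hu1 : (42 : ZMod 181) ≠ 1 := by decide
  haveI : Fact (Nat.Prime 181) := ⟨by norm_num⟩
  haveI : Fact (Nat.Prime 5) := ⟨by norm_num⟩
  exact atomBad_of_frobenius_model hpq (42 : ZMod 181) hu1 not_boxUseful_frob905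

/-- `AtomBad 191 5`. [folklore] -/
theorem atomBad_191_5 : AtomBad.{w} 191 5 := by
  have hpq : (191 : ℕ) ≠ 5 := by decide
  have hu1 : (39 : ZMod 191) ≠ 1 := by decide
  haveI : Fact (Nat.Prime 191) := ⟨by norm_num⟩
  haveI : Fact (Nat.Prime 5) := ⟨by norm_num⟩
  exact atomBad_of_frobenius_model hpq (39 : ZMod 191) hu1 not_boxUseful_frob955

/-- `AtomBad 29 7`. [folklore] -/
theorem atomBad_29_7 : AtomBad.{w} 29 7 := by
  have hpq : (29 : ℕ) ≠ 7 := by decide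
  have hu1 : (7 : ZMod 29) ≠ 1 := by decide
  haveI : Fact (Nat.Prime 29) := ⟨by norm_num⟩
  haveI : Fact (Nat.Prime 7) := ⟨by norm_num⟩
  exact atomBad_of_frobenius_model hpq (7 : ZMod 29) hu1 not_boxUseful_frob203

/-- `AtomBad 43 7`. [folklore] -/
theorem atomBad_43_7 : AtomBad.{w} 43 7 := by
  have hpq : (43 : ℕ) ≠ 7 := by decide
  have hu1 : (4 : ZMod 43) ≠ 1 := by decide
  haveI : Fact (Nat.Prime 43) := ⟨by norm_num⟩
  haveI : Fact (Nat.Prime 7) := ⟨by norm_num⟩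
  exact atomBad_of_frobenius_model hpq (4 : ZMod 43) hu1 not_boxUseful_frob301

/-- `AtomBad 71 7`. [folklore] -/
theorem atomBad_71_7 : AtomBad.{w} 71 7 := by
  have hpq : (71 : ℕ) ≠ 7 := by decide
  have hu1 : (20 : ZMod 71) ≠ 1 := by decide
  haveI : Fact (Nat.Prime 71) := ⟨by norm_num⟩
  haveI : Fact (Nat.Prime 7) := ⟨by norm_num⟩
  exact atomBad_of_frobenius_model hpq (20 : ZMod 71) hu1 not_boxUseful_frob497

/-- `AtomBad 113 7`. [folklore] -/
theorem atomBad_113_7 : AtomBad.{w} 113 7 := by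
  have hpq : (113 : ℕ) ≠ 7 := by decide
  have hu1 : (16 : ZMod 113) ≠ 1 := by decide
  haveI : Fact (Nat.Prime 113) := ⟨by norm_num⟩
  haveI : Fact (Nat.Prime 7) := ⟨by norm_num⟩
  exact atomBad_of_frobenius_model hpq (16 : ZMod 113) hu1 not_boxUseful_frob791

/-- `AtomBad 127 7`. [folklore] -/
theorem atomBad_127_7 : AtomBad.{w} 127 7 := by
  have hpq : (127 : ℕ) ≠ 7 := by decide
  have hu1 : (2 : ZMod 127) ≠ 1 := by decide
  haveI : Fact (Nat.Prime 127) := ⟨by norm_num⟩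
  haveI : Fact (Nat.Prime 7) := ⟨by norm_num⟩
  exact atomBad_of_frobenius_model hpq (2 : ZMod 127) hu1 not_boxUseful_frob889

/-- `AtomBad 23 11`. [folklore] -/
theorem atomBad_23_11 : AtomBad.{w} 23 11 := by
  have hpq : (23 : ℕ) ≠ 11 := by decide
  have hu1 : (2 : ZMod 23) ≠ 1 := by decide
  haveI : Fact (Nat.Prime 23) := ⟨by norm_num⟩
  haveI : Fact (Nat.Prime 11) := ⟨by norm_num⟩
  exact atomBad_of_frobenius_model hpq (2 : ZMod 23) hu1 not_boxUseful_frob253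

/-- `AtomBad 67 11`. [folklore] -/
theorem atomBad_67_11 : AtomBad.{w} 67 11 := by
  have hpq : (67 : ℕ) ≠ 11 := by decide
  have hu1 : (9 : ZMod 67) ≠ 1 := by decide
  haveI : Fact (Nat.Prime 67) := ⟨by norm_num⟩
  haveI : Fact (Nat.Prime 11) := ⟨by norm_num⟩
  exact atomBad_of_frobenius_model hpq (9 : ZMod 67) hu1 not_boxUseful_frob737

/-- `AtomBad 89 11`. [folklore] -/
theorem atomBad_89_11 : AtomBad.{w} 89 11 := by
  have hpq : (89 : ℕ) ≠ 11 := by decide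
  have hu1 : (2 : ZMod 89) ≠ 1 := by decide
  haveI : Fact (Nat.Prime 89) := ⟨by norm_num⟩
  haveI : Fact (Nat.Prime 11) := ⟨by norm_num⟩
  exact atomBad_of_frobenius_model hpq (2 : ZMod 89) hu1 not_boxUseful_frob979

/-- `AtomBad 53 13`. [folklore] -/
theorem atomBad_53_13 : AtomBad.{w} 53 13 := by
  have hpq : (53 : ℕ) ≠ 13 := by decide
  have hu1 : (10 : ZMod 53) ≠ 1 := by decide
  haveI : Fact (Nat.Prime 53) := ⟨by norm_num⟩
  haveI : Fact (Nat.Prime 13) := ⟨by norm_num⟩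
  exact atomBad_of_frobenius_model hpq (10 : ZMod 53) hu1 not_boxUseful_frob689

end Instances

end Summit.MatrixMultiplication.OmegaCensus
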